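import Summits.BirchSwinnertonDyer.Rank1Residual.Additive.KatoDescentDatum
import Literature.NumberTheory.EllipticCurves.Kato2004.IwasawaH2Descent
import Literature.NumberTheory.EllipticCurves.Kato2004.LocPKummerLog
import HarnessLib

set_option linter.dupNamespace false
set_option autoImplicit false

/-! # `IsKatoDescentDatumOfH2 W p D` (v2 of the pin; plan g13 RULING 2026-08-26T18:51:14Z «GO-v2, KEEP v1»):
# bsd-potss's abstract `KatoDescentDatum p` pinned to bsd-smallim's `𝐇¹_Γ(T_pW)` (`Kato2004.IwasawaH1Data`)
# and bsd-cn100-ty's `𝐇²_Γ(T_pW)` descent package (`Kato2004.IwasawaH2Data`, (14.14.1) with `A = H¹(ℤ[1/p],T_pW)`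
# and `ι = proj₀` pinned) — no fine-Selmer comparison, no Poitou–Tate over `ℚ_∞`

Cell `bsd-cn100`, prover seat `bsd-cn100-s2-c3` (g7). Helper for stmt-BirchSwinnertonDyer-19080 (the
definition ITEM `defn-IsKatoDescentDatumOf` is served by v1, `Theorems/CongruentShaFreeCutKatoDescentDatumOf`,
p460217; this is the variant over which the Kato–zeta road is to be REGISTERED, plan g13 18:51:14Z (ii)).
HONEST FRAMING: a DEFINITION (a structure of identifications and one `Prop`) plus one plumbing `def` and
unfolding lemmas; nothing is asserted, no named fact is minted, no instance/notation is declared (the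
`ContinuousSMul ℤ_[p] (T_pW)` structure fact is an instance BINDER, discharged inside `IsKatoDescentDatumOfH2`
by `TateModule.continuousSMul_padicInt`); nothing about BSD, crux B of route `CongruentShaFreeCut` or the
congruent number problem is proved. Imports: bsd-potss's `KatoDescentDatum` (Summits-side, hence this file
is Summits-side), the Literature packages, and NO `Theses` module (build rule 2026-08-26T19:13:48Z (H)).
PARTITION: none — RANK axis.

## v2 versus v1

v1 (`KatoDescentDatumPin`, p460217) pins `D.H2` to the tree's fine-Selmer dual `X_st(E/ℚ_∞)` up to
`p`-power torsion — a comparison (`𝐇²_Γ ≈ X_st`, Poitou–Tate over `ℚ_∞`) that is thin in print at an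
additive prime. v2 pins `D.H2 ≃ₗ[Λ] J.H2` for a descent package `J : Kato2004.IwasawaH2Data W p κ γ I`
(bsd-cn100-ty, `Kato2004/IwasawaH2Descent.lean`): `J.H2 = 𝐇²_Γ(T_pW)` abstract with (12.2.1)/Thm. 12.4 (1),
`J.A = H¹(ℤ[1/p], T_pW)` PINNED by `J.toH1` onto `integralH1`, and (14.14.1) `0 → 𝐇¹_Γ/T →ι A →π 𝐇²_Γ[T] → 0`
with `J.ι` PINNED to `proj₀`. So on v2 the road's readings are Kato's own statements: (R) = Kato Thm. 12.4 +
(14.14.1) (`Kato2004.nonempty_iwasawaH2Data`), (K) = Conj. 12.10 in `Λ ⊗ ℚ` on `𝐇²` = Burungale–Tian 2026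
Thm. 2.6 / [ABS] Thm. 10.6 verbatim, (3.1′) = (14.9.3) + (14.14.2). As in v1, `D.z` is NOT pinned beyond
`D`'s own axioms (`z ≠ 0`, `D.H/Λz` torsion): with `D.H ≅ 𝐇¹_Γ` (free of rank one over `Λ[1/p]`, Thm. 12.4
(2)) and (14.14.1) pinning `H2[T] ≅ coker(proj₀)`, a consumer's hypothesis (K) forces
`D.z ∈ f·Λˣ·p^ℤ·𝐳_E` with `f(0) ≠ 0`, so `ι[z]` is a non-zero `ℤ_p[1/p]`-multiple of Kato's class — which every
«`∃ c ≠ 0`» statement of the road absorbs; CONSUMERS QUANTIFY `∀ D` pinned WITH (K).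

References: K. Kato, Astérisque 295 (2004), Thm. 12.4 (p. 221), Conj. 12.10 (p. 224), §14.14 (14.14.1)–(14.14.2)
(p. 243), §8.2/Lemma 8.5 (pp. 180–184) [Kato2004Asterisque]; Burungale–Skinner, App. A to arXiv:2210.10730,
§10.1.1 (p. 33), Thm. 10.6 [AlpogeBhargavaShnidman2022]; Burungale–Tian, Ann. of Math. 203 (2026) Thm. 2.6
[BurungaleTian2026]; tree: `Rank1Residual/Additive/KatoDescentDatum.lean` (bsd-potss),
`Kato2004/IwasawaCohomology.lean`, `Kato2004/IwasawaH2Descent.lean`, `Kato2004/LocPKummerLog.lean`.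
-/

noncomputable section

open scoped Classical

namespace Summit.BirchSwinnertonDyer.BirchSwinnertonDyer.Theorems.CongruentShaFreeCutKatoDescentDatumOfH2

open WeierstrassCurve Field Literature.NumberTheory.EllipticCurves
  Literature.NumberTheory.EllipticCurves.Kato2004 Literature.NumberTheory.EllipticCurves.IwasawaAlgebra
  Literature.NumberTheory.EllipticCurves.Kato2004.EulerSystemValues
  Literature.NumberTheory.GaloisRepresentations
open Summit.BirchSwinnertonDyer.Rank1Residual.Additive (KatoDescentDatum)

/-! ## §1 The structure of identifications (v2) -/

/-- **The v2 PIN of an abstract Kato descent datum `D : KatoDescentDatum p` to the tree's packages for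
`T = T_pW`**: a CYCLOTOMIC `ℤ_p`-extension datum `(κ, γ)`, bsd-smallim's `I : IwasawaH1Data W p κ γ`
(`𝐇¹_Γ(T_pW)`), bsd-cn100-ty's descent package `J : IwasawaH2Data W p κ γ I` (`𝐇²_Γ(T_pW)` with (14.14.1),
`A` and `ι` pinned), and `Λ`-linear identifications `eH : D.H ≃ I.H`, `eH2 : D.H2 ≃ J.H2`, `eA : D.A ≃ J.A`
carrying `D.ι` to `J.ι` (`eA_ι`) and `D.π` to `J.π` (`eH2_π`, on underlying elements of the invariants).
`D.z` is not constrained beyond `D`'s own axioms (module docstring). Nothing asserted.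
[cite: Kato2004Asterisque, Thm. 12.4 (p. 221) and §14.14 (14.14.1) (p. 243)]
[cite: AlpogeBhargavaShnidman2022, App. A §10.1.1 (p. 33)] -/
structure KatoDescentDatumPinH2 (W : WeierstrassCurve ℚ) [W.IsElliptic] (p : ℕ) [Fact p.Prime]
    [ContinuousSMul ℤ_[p] (W.tateModule p)] (D : KatoDescentDatum p) where
  /-- The cyclotomic `ℤ_p`-extension `ℚ_∞/ℚ`. -/
  κ : ZpExtension ℚ p
  /-- `κ` IS the cyclotomic `ℤ_p`-extension. -/
  isCyclotomic : κ.IsCyclotomic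
  /-- A topological generator `γ` of `Γ = Gal(ℚ_∞/ℚ)`. -/
  γ : absoluteGaloisGroup ℚ
  /-- `γ` generates `Γ` topologically. -/
  isTopGenerator : κ.IsTopGenerator γ
  /-- bsd-smallim's pinned Iwasawa cohomology `𝐇¹_Γ(T_pW)` along `κ`. -/
  I : IwasawaH1Data W p κ γ
  /-- bsd-cn100-ty's descent package: `𝐇²_Γ(T_pW)`, `A = H¹(ℤ[1/p], T_pW)`, (14.14.1). -/
  J : IwasawaH2Data W p κ γ I
  /-- `D.H` IS `𝐇¹_Γ(T_pW)`. -/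
  eH : D.H ≃ₗ[IwasawaAlgebra p] I.H
  /-- `D.H2` IS `𝐇²_Γ(T_pW)` (the package's `H2`). -/
  eH2 : D.H2 ≃ₗ[IwasawaAlgebra p] J.H2
  /-- `D.A` IS `H¹(ℤ[1/p], T_pW)` (the package's pinned `A`). -/
  eA : D.A ≃ₗ[IwasawaAlgebra p] J.A
  /-- `D.ι` IS the package's `ι` (= `proj₀` by `J.toH1_ι`): `eA (D.ι [x]) = J.ι [eH x]`. -/
  eA_ι : ∀ x : D.H,
    eA (D.ι (Submodule.Quotient.mk x)) = J.ι (Submodule.Quotient.mk (eH x))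
  /-- `D.π` IS the package's `π` (compatibility on underlying elements of the `Γ`-invariants). -/
  eH2_π : ∀ a : D.A,
    eH2 ((D.π a : IwasawaAlgebra.invariants p D.H2) : D.H2) =
      ((J.π (eA a) : IwasawaAlgebra.invariants p J.H2) : J.H2)

/-- **`IsKatoDescentDatumOfH2 W p D`: «`D` IS Kato's §14.14 descent datum of `T_pW`» (v2, over the `𝐇²`
package)** — `D` admits a v2 pin. The `ContinuousSMul ℤ_[p] (T_pW)` structure fact is supplied by
`TateModule.continuousSMul_padicInt`. A `Prop`; nothing asserted; realisability (reading (R): Kato Thm.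
12.4, (14.14.1), `Kato2004.nonempty_iwasawaH1Data` ∧ `nonempty_iwasawaH2Data`) is not claimed here.
[cite: Kato2004Asterisque, Thm. 12.4 (p. 221) and §14.14 (14.14.1) (p. 243)] -/
def IsKatoDescentDatumOfH2 (W : WeierstrassCurve ℚ) [W.IsElliptic] (p : ℕ) [Fact p.Prime]
    (D : KatoDescentDatum p) : Prop :=
  letI : ContinuousSMul ℤ_[p] (W.tateModule p) := TateModule.continuousSMul_padicInt
  Nonempty (KatoDescentDatumPinH2 W p D)

/-! ## §2 Unfolding lemmas and the pinned Kato class -/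

section Unfolding

variable {W : WeierstrassCurve ℚ} [W.IsElliptic] {p : ℕ} [Fact p.Prime] {D : KatoDescentDatum p}

/-- Unfolding: `IsKatoDescentDatumOfH2 W p D` is the inhabitedness of `KatoDescentDatumPinH2 W p D`.
[cite: Kato2004Asterisque, §14.14 (14.14.1) (p. 243)] -/
theorem isKatoDescentDatumOfH2_iff :
    IsKatoDescentDatumOfH2 W p D ↔
      Nonempty (@KatoDescentDatumPinH2 W _ p _ TateModule.continuousSMul_padicInt D) :=
  Iff.rfl

/-- A v2 pin yields `IsKatoDescentDatumOfH2` (any instance of the `Prop`-valued structure fact).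
[cite: Kato2004Asterisque, §14.14 (14.14.1) (p. 243)] -/
theorem isKatoDescentDatumOfH2_of_pin [inst : ContinuousSMul ℤ_[p] (W.tateModule p)]
    (P : KatoDescentDatumPinH2 W p D) : IsKatoDescentDatumOfH2 W p D := by
  have h : inst = TateModule.continuousSMul_padicInt := Subsingleton.elim _ _
  subst h
  exact ⟨P⟩

end Unfolding

namespace KatoDescentDatumPinH2

variable {W : WeierstrassCurve ℚ} [W.IsElliptic] {p : ℕ} [Fact p.Prime]
  [ContinuousSMul ℤ_[p] (W.tateModule p)] {D : KatoDescentDatum p} (P : KatoDescentDatumPinH2 W p D)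

/-- **The pinned class `ι[x] ∈ H¹(ℚ, T_pW)` is `proj₀ (eH x)`**: `toH1 (eA (D.ι [x])) = I.proj 0 (eH x)`
(`eA_ι` and the package's `toH1_ι`). [cite: Kato2004Asterisque, §14.14 (14.14.1) (p. 243)] -/
theorem toH1_eA_ι (x : D.H) :
    P.J.toH1 (P.eA (D.ι (Submodule.Quotient.mk x))) = P.I.proj 0 (P.eH x) := by
  rw [P.eA_ι, P.J.toH1_ι]

/-- The pinned class is an INTEGRAL class `H¹(ℤ[1/p], T_pW)`. [cite: Kato2004Asterisque, §8.2 and §14.14 (pp. 180, 243)] -/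
theorem toH1_eA_ι_mem (x : D.H) :
    P.J.toH1 (P.eA (D.ι (Submodule.Quotient.mk x))) ∈ integralH1 (tateRep W p) p (P.κ.layerSubgroup 0) := by
  rw [P.toH1_eA_ι]
  exact P.I.proj_mem 0 _

/-- `toH1 ∘ eA` transports the action of `p^m ∈ Λ` on `D.A` to multiplication by `p^m` (the package's
`toH1_smul`: `Λ` acts through the augmentation). [cite: Kato2004Asterisque, §14.14 (14.14.1) (p. 243)] -/
theorem toH1_eA_natCast_pow_smul (m : ℕ) (a : D.A) :
    P.J.toH1 (P.eA (((p : IwasawaAlgebra p) ^ m) • a)) = ((p : ℤ_[p]) ^ m) • P.J.toH1 (P.eA a) := by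
  rw [map_smul, P.J.toH1_smul, map_pow, map_natCast]

/-- **The pinned Kato class** `ι[z] ∈ H¹(Γ_ℚ, T_pW)` on a v2 pin, moved to the subgroup `⊤`
(`Kato2004.layerZeroToTop`) — the argument slot of `Kato2004.HasLocPKummerLog`. Plumbing (data, not a
proposition). [cite: Kato2004Asterisque, §14.14 (14.14.1) (p. 243)] [cite: AlpogeBhargavaShnidman2022, App. A §10.1.1 (the class `z_E`)] -/
def katoClass : H1 (tateRep W p) ⊤ :=
  Kato2004.layerZeroToTop W p P.κ (P.J.toH1 (P.eA (D.ι (Submodule.Quotient.mk D.z))))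

/-- `katoClass = layerZeroToTop (proj₀ (eH z))` — the class depends on the pin only through `(κ, I, eH)`.
[cite: Kato2004Asterisque, §14.14 (14.14.1) (p. 243)] -/
theorem katoClass_eq : P.katoClass = Kato2004.layerZeroToTop W p P.κ (P.I.proj 0 (P.eH D.z)) := by
  rw [katoClass, P.toH1_eA_ι]

end KatoDescentDatumPinH2

end Summit.BirchSwinnertonDyer.BirchSwinnertonDyer.Theorems.CongruentShaFreeCutKatoDescentDatumOfH2

end
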